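import Literature.IUT.HodgeTheaters.InitialThetaDataOvergroupStable
import Literature.IUT.HodgeTheaters.PiAvatarOrbitCategorySquares
import Literature.IUT.HodgeTheaters.PiAvatarBinding
import HarnessLib

/-!
# KIT-INSTANCE-SPEC P5-binding: the slots `pmObj` / `toPM` at a good place `v̲` in the EMBEDDED design D1 — the characteristic
# overgroup `Π_{X_K} ∩ augGF⁻¹(G_v) ⊇ Π_v̲ = Π_{X̲→_K} ∩ augGF⁻¹(G_v)` ([IUTchI] Def 6.1 (ii)) (defs — post-freeze additive D13,
# not a cone member), over abc-iut-L5-t1's `InitialThetaDataOvergroupStable` (p431988)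

S. Mochizuki, *Inter-universal Teichmüller theory I*, kurims manuscript (May 2020), Def 6.1 (ii) p. 156 («… determines, in a
functorial fashion, a [pro]finite group corresponding to "`X_v`" … containing `π₁(†𝒟_v)` as an open subgroup»), Cor 1.2
([IUTchI] Def 6.1 (ii) p.156) [claim: Mochizuki2012, status: disputed] (D-0012 claim key, series status DISPUTED — definitions over
abc-iut-L5-t2's REAL `InitialThetaData`; nothing of the series is asserted, no side is taken on [IUTchIII] Cor. 3.12).

WHAT IS BUILT (good `v̲`, local Galois group `G_v ≤ G_F` as a parameter, as in `PiAvatarBinding.locModelObj`):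
* `InitialThetaData.pmObjModel Gv := OrbitCat.of (Π_{X_K} ∩ augGF⁻¹(G_v))` — the `±`-object `𝒟_v^±`-type overgroup of the model
  local object `locModelObj Gv = ℬ(Π_{X̲→_K} ∩ augGF⁻¹(G_v))⁰`; `toPMModel Gv : locModelObj Gv ⟶ pmObjModel Gv` (`homOfElem 1`,
  t1's `PiXarrow_inf_le_PiXK_inf`), `fn_toPMModel`;
* **functoriality in automorphisms** (the content of "functorial fashion"/Cor 1.2 in the embedded design, t1 08:09Z): every
  automorphism `xΠ_v̲ ↦ xaΠ_v̲` of the local object EXTENDS to the automorphism `xΠ^± ↦ xaΠ^±` of the overgroup object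
  (`a` normalises `Π^±` by t1's `normalizer_PiXarrow_inf_le`), compatibly with `toPM`: `autPMOfAut`, **`toPMModel_autPMOfAut`**
  (the square `aut a ≫ toPM = toPM ≫ autPM a`, abc-iut-L5-t13's `OrbitCat.autOfNormalizer_comp_incl`).
No instance/notation declared; typed ≠ proved elsewhere.
-/

noncomputable section

namespace Literature.IUT.HodgeTheaters

open CategoryTheory

universe u v w

section LocalOvergroup

variable {F : Type u} {K : Type v} {Fbar : Type w} [Field F] [NumberField F] [Field K] [NumberField K]
  [Algebra F K] [Field Fbar] [Algebra F Fbar] [Algebra K Fbar]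
  {E : WeierstrassCurve F} [E.IsElliptic] {l : ℕ} {Pb : BadPlacePredicates K}
  (D : InitialThetaData F K Fbar E l Pb) (Gv : Subgroup (Fbar ≃ₐ[F] Fbar))

namespace InitialThetaData

/-- **Kit slot `pmObj` at the model local object of a good `v̲`**: `ℬ(Π_{X_K} ∩ augGF⁻¹(G_v))⁰`, the "`X_v`"-type overgroup object
([IUTchI] Def 6.1 (ii)). ([IUTchI] Def 6.1 (ii) p.156) [claim: Mochizuki2012, status: disputed] -/
abbrev pmObjModel : D.PiAmbient := OrbitCat.of (D.PiXK ⊓ Gv.comap D.augGF)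

/-- **Kit slot `toPM` at the model**: the covering `ℬ(Π_v̲)⁰ → ℬ(Π^±_v̲)⁰`, `xΠ_v̲ ↦ xΠ^±_v̲` (`Π_v̲ ≤ Π^±_v̲`, t1's `PiXarrow_inf_le_PiXK_inf`).
([IUTchI] Def 6.1 (ii) p.156) [claim: Mochizuki2012, status: disputed] -/
def toPMModel : D.locModelObj Gv ⟶ D.pmObjModel Gv :=
  OrbitCat.homOfElem 1 (OrbitCat.one_conj_mem_of_le (D.PiXarrow_inf_le_PiXK_inf Gv))

/-- `toPM` on cosets: `xΠ_v̲ ↦ xΠ^±_v̲`. ([IUTchI] Def 6.1 (ii) p.156) [claim: Mochizuki2012, status: disputed] -/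
theorem fn_toPMModel (x : D.PiC) :
    OrbitCat.fn (D.toPMModel Gv) (QuotientGroup.mk x : D.PiC ⧸ (D.PiXarrow ⊓ Gv.comap D.augGF)) =
      (QuotientGroup.mk (x * 1) : D.PiC ⧸ (D.PiXK ⊓ Gv.comap D.augGF)) :=
  OrbitCat.fn_homOfElem (H := D.PiXarrow ⊓ Gv.comap D.augGF) (K := D.PiXK ⊓ Gv.comap D.augGF) 1 _ x

/-- **Functoriality (Cor 1.2 in the embedded design)**: an automorphism `xΠ_v̲ ↦ xaΠ_v̲` of the local object extends to the
automorphism `xΠ^± ↦ xaΠ^±` of the overgroup object (`a` normalises `Π^±_v̲`: t1's `normalizer_PiXarrow_inf_le`).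
([IUTchI] Def 6.1 (ii) p.156) [claim: Mochizuki2012, status: disputed] -/
def autPMOfAut (a : D.PiC)
    (ha : a ∈ Subgroup.normalizer ((D.PiXarrow ⊓ Gv.comap D.augGF : Subgroup D.PiC) : Set D.PiC)) :
    D.pmObjModel Gv ≅ D.pmObjModel Gv :=
  OrbitCat.autOfNormalizer a (D.normalizer_PiXarrow_inf_le Gv ha)

/-- **Compatibility square** `(xΠ_v̲ ↦ xaΠ_v̲) ≫ toPM = toPM ≫ (xΠ^± ↦ xaΠ^±)` (abc-iut-L5-t13's `OrbitCat.autOfNormalizer_comp_incl`).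
([IUTchI] Def 6.1 (ii) p.156) [claim: Mochizuki2012, status: disputed] -/
theorem toPMModel_autPMOfAut (a : D.PiC)
    (ha : a ∈ Subgroup.normalizer ((D.PiXarrow ⊓ Gv.comap D.augGF : Subgroup D.PiC) : Set D.PiC)) :
    (OrbitCat.autOfNormalizer a ha).hom ≫ D.toPMModel Gv = D.toPMModel Gv ≫ (D.autPMOfAut Gv a ha).hom :=
  OrbitCat.autOfNormalizer_comp_incl (D.PiXarrow_inf_le_PiXK_inf Gv) ha (D.normalizer_PiXarrow_inf_le Gv ha)

/-- The extension is unique in the sense that matters: automorphisms inducing the same map of the local object (`a⁻¹b ∈ Π_v̲`)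
induce the same map of the overgroup object (`a⁻¹b ∈ Π^±_v̲`). ([IUTchI] Def 6.1 (ii) p.156) [claim: Mochizuki2012, status: disputed] -/
theorem autPMOfAut_eq_of_eq {a b : D.PiC}
    (ha : a ∈ Subgroup.normalizer ((D.PiXarrow ⊓ Gv.comap D.augGF : Subgroup D.PiC) : Set D.PiC))
    (hb : b ∈ Subgroup.normalizer ((D.PiXarrow ⊓ Gv.comap D.augGF : Subgroup D.PiC) : Set D.PiC))
    (h : OrbitCat.autOfNormalizer a ha = OrbitCat.autOfNormalizer b hb) :
    D.autPMOfAut Gv a ha = D.autPMOfAut Gv b hb := by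
  rw [OrbitCat.autOfNormalizer_eq_iff] at h
  rw [autPMOfAut, autPMOfAut, OrbitCat.autOfNormalizer_eq_iff]
  exact D.PiXarrow_inf_le_PiXK_inf Gv h

end InitialThetaData

end LocalOvergroup

end Literature.IUT.HodgeTheaters
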